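import Mathlib
import HarnessLib
import Summits.QuantumFields.YangMills.Theses.PencilRigidity

/-!
# `CurvatureKernelBound` — stub A4 support: flatness of `⁰𝒮` test functions at the diagonal

Support file for crux `stmt-QuantumFields-11687` (`PencilRigidity.CurvatureKernelBound`), line
`sixteen-charts-analytic-kernel`, stub `OffDiagonalExtension` (A4).  Pure analysis:

* `norm_le_of_iteratedFDeriv_eq_zero`: Taylor flatness along a segment — if all derivatives of order
  `< m` of a smooth `g` vanish at `a` and `‖D^m g‖ ≤ B` on the segment `[a, a + w]`, then
  `‖g (a + w)‖ ≤ B ‖w‖^m`;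
* `one_add_pow_mul_norm_iteratedFDeriv_le_of_isOffDiagonal`: for a two-point test function
  `F ∈ ⁰𝒮` every weighted derivative is flat at the diagonal,
  `(1 + ‖x‖)^k ‖D^l F x‖ ≤ C ‖x₀ - x₁‖^m`;
* consequences for a kernel `K(x₀ - x₁)` with `K` continuous off `0` and polynomially bounded at `0`
  and `∞`: the integrand `K(x₀ - x₁) F x` is rapidly decreasing, continuous and integrable.
[folklore]
-/

noncomputable section

open scoped SchwartzMap ContDiff Topology
open Set MeasureTheory Metric Filter
open Literature.MathematicalPhysics.AQFT Literature.MathematicalPhysics.QuantumLattice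

namespace Summit.QuantumFields.YangMills.Theorems.CurvatureKernel

/-! ## Taylor flatness along a segment -/

/-- Norm of an iterated derivative of an iterated derivative. [folklore] -/
theorem norm_iteratedFDeriv_iteratedFDeriv {V W : Type*} [NormedAddCommGroup V] [NormedSpace ℝ V]
    [NormedAddCommGroup W] [NormedSpace ℝ W] (f : V → W) (j l : ℕ) (x : V) :
    ‖iteratedFDeriv ℝ j (iteratedFDeriv ℝ l f) x‖ = ‖iteratedFDeriv ℝ (l + j) f x‖ := by
  induction j generalizing l with
  | zero => simp
  | succ j ih =>
    rw [← norm_iteratedFDeriv_fderiv, fderiv_iteratedFDeriv,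
      LinearIsometryEquiv.norm_iteratedFDeriv_comp_left, ih (l + 1), Nat.add_right_comm,
      Nat.add_assoc]

/-- **Taylor flatness along a segment.** If `g` is smooth, all derivatives of order `< m` of `g`
vanish at `a`, and `‖D^m g‖ ≤ B` on the segment `s ↦ a + s • w`, `s ∈ [0, 1]`, then
`‖g (a + t • w)‖ ≤ B ‖w‖ ^ m` for `t ∈ [0, 1]` (induction on `m` via `x ↦ Dg(x) w` and the mean value
inequality). [folklore] -/
theorem norm_le_of_iteratedFDeriv_eq_zero {V W : Type*} [NormedAddCommGroup V] [NormedSpace ℝ V]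
    [NormedAddCommGroup W] [NormedSpace ℝ W] :
    ∀ (m : ℕ) (g : V → W) (a w : V) (B : ℝ), ContDiff ℝ ∞ g →
      (∀ j < m, iteratedFDeriv ℝ j g a = 0) →
      (∀ s ∈ Icc (0 : ℝ) 1, ‖iteratedFDeriv ℝ m g (a + s • w)‖ ≤ B) →
      ∀ t ∈ Icc (0 : ℝ) 1, ‖g (a + t • w)‖ ≤ B * ‖w‖ ^ m := by
  intro m
  induction m with
  | zero =>
    intro g a w B _ _ hB t ht
    simpa using hB t ht
  | succ m ih =>
    intro g a w B hg h0 hB t ht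
    have hfd : ContDiff ℝ ∞ (fderiv ℝ g) := (contDiff_infty_iff_fderiv.1 hg).2
    have hg' : ContDiff ℝ ∞ (fun x => fderiv ℝ g x w) := hfd.clm_apply contDiff_const
    have h0' : ∀ j < m, iteratedFDeriv ℝ j (fun x => fderiv ℝ g x w) a = 0 := by
      intro j hj
      have h := norm_iteratedFDeriv_clm_apply_const (f := fderiv ℝ g) (c := w) (x := a) (N := ∞)
        (n := j) hfd.contDiffAt (mod_cast le_top)
      rw [norm_iteratedFDeriv_fderiv, h0 (j + 1) (by omega), norm_zero, mul_zero] at h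
      exact norm_le_zero_iff.1 h
    have hB' : ∀ s ∈ Icc (0 : ℝ) 1,
        ‖iteratedFDeriv ℝ m (fun x => fderiv ℝ g x w) (a + s • w)‖ ≤ ‖w‖ * B := by
      intro s hs
      have h := norm_iteratedFDeriv_clm_apply_const (f := fderiv ℝ g) (c := w) (x := a + s • w)
        (N := ∞) (n := m) hfd.contDiffAt (mod_cast le_top)
      rw [norm_iteratedFDeriv_fderiv] at h
      exact h.trans (mul_le_mul_of_nonneg_left (hB s hs) (norm_nonneg _))
    have hih := ih (fun x => fderiv ℝ g x w) a w (‖w‖ * B) hg' h0' hB'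
    have hga : g a = 0 := by
      have h2 : ‖g a‖ = 0 := by
        rw [← norm_iteratedFDeriv_zero (𝕜 := ℝ), h0 0 (Nat.succ_pos m), norm_zero]
      exact norm_eq_zero.1 h2
    have hderiv : ∀ s ∈ Icc (0 : ℝ) 1, HasDerivWithinAt (fun s : ℝ => g (a + s • w))
        (fderiv ℝ g (a + s • w) w) (Icc 0 1) s := by
      intro s _
      have h1 : HasDerivAt (fun s : ℝ => a + s • w) w s := by
        simpa using ((hasDerivAt_id s).smul_const w).const_add a
      have h2 : HasFDerivAt g (fderiv ℝ g (a + s • w)) (a + s • w) :=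
        ((hg.differentiable (by simp)) _).hasFDerivAt
      exact (h2.comp_hasDerivAt s h1).hasDerivWithinAt
    have hbound : ∀ s ∈ Ico (0 : ℝ) 1, ‖fderiv ℝ g (a + s • w) w‖ ≤ ‖w‖ * B * ‖w‖ ^ m :=
      fun s hs => hih s (Ico_subset_Icc_self hs)
    have hBnn : 0 ≤ B := le_trans (norm_nonneg _) (hB 0 ⟨le_rfl, zero_le_one⟩)
    have h := norm_image_sub_le_of_norm_deriv_le_segment' hderiv hbound t ht
    simp only [zero_smul, add_zero, hga, sub_zero] at h
    calc ‖g (a + t • w)‖ ≤ ‖w‖ * B * ‖w‖ ^ m * t := h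
      _ ≤ ‖w‖ * B * ‖w‖ ^ m * 1 := by
        have : 0 ≤ ‖w‖ * B * ‖w‖ ^ m := by positivity
        exact mul_le_mul_of_nonneg_left (by linarith [ht.2]) this
      _ = B * ‖w‖ ^ (m + 1) := by ring

/-! ## Flatness of `⁰𝒮` two-point functions at the diagonal -/

/-- **Flatness estimate.** For `F ∈ ⁰𝒮((E)²)` and `k m N : ℕ` there is `C ≥ 0` with
`(1 + ‖x‖)^k ‖D^l F(x)‖ ≤ C ‖x₀ - x₁‖^m` for all `l ≤ N` and all `x`: near the diagonal apply
Taylor flatness along the segment from the coincident point `(x₁, x₁)` to `x` (length `‖x₀ - x₁‖`) to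
`D^l F`, using the Schwartz decay of `D^{l+m} F` on the segment; far from it use plain Schwartz decay.
[folklore] -/
theorem one_add_pow_mul_norm_iteratedFDeriv_le_of_isOffDiagonal
    {E : Type*} [NormedAddCommGroup E] [NormedSpace ℝ E]
    (F : 𝓢((Fin 2 → E), ℂ)) (hF : IsOffDiagonal F) (k m N : ℕ) :
    ∃ C, 0 ≤ C ∧ ∀ l ≤ N, ∀ x : Fin 2 → E,
      (1 + ‖x‖) ^ k * ‖iteratedFDeriv ℝ l (F : (Fin 2 → E) → ℂ) x‖ ≤ C * ‖x 0 - x 1‖ ^ m := by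
  set S : ℝ := (Finset.Iic (k, N + m)).sup (fun p => SchwartzMap.seminorm ℂ p.1 p.2) F with hS
  have hS0 : 0 ≤ S := apply_nonneg _ _
  refine ⟨2 ^ k * 2 ^ k * S, by positivity, ?_⟩
  intro l hl x
  -- Schwartz decay of all derivatives of order `≤ N + m` with weight `k`
  have hdec : ∀ n ≤ N + m, ∀ y : Fin 2 → E,
      (1 + ‖y‖) ^ k * ‖iteratedFDeriv ℝ n (F : (Fin 2 → E) → ℂ) y‖ ≤ 2 ^ k * S := fun n hn y =>
    SchwartzMap.one_add_le_sup_seminorm_apply (𝕜 := ℂ) (m := (k, N + m)) le_rfl hn F y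
  by_cases hξ : ‖x 0 - x 1‖ ≤ 1
  · -- the coincident base point `a = (x₁, x₁)` and the direction `w = (x₀ - x₁, 0)`
    set a : Fin 2 → E := fun _ => x 1 with ha_def
    set w : Fin 2 → E := x - a with hw_def
    have hxw : a + (1 : ℝ) • w = x := by simp [hw_def]
    have hw : ‖w‖ ≤ ‖x 0 - x 1‖ := by
      refine (pi_norm_le_iff_of_nonneg (norm_nonneg _)).2 fun i => ?_
      fin_cases i <;> simp [hw_def, ha_def]
    have ha : a ∈ coincidenceLocus 2 E := ⟨0, 1, by decide, rfl⟩
    have hg : ContDiff ℝ ∞ (iteratedFDeriv ℝ l (F : (Fin 2 → E) → ℂ)) :=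
      contDiff_infty.2 fun n => (F.smooth ⊤).iteratedFDeriv_right (by exact_mod_cast le_top)
    have h0 : ∀ j < m, iteratedFDeriv ℝ j (iteratedFDeriv ℝ l (F : (Fin 2 → E) → ℂ)) a = 0 := by
      intro j _
      have h := norm_iteratedFDeriv_iteratedFDeriv (F : (Fin 2 → E) → ℂ) j l a
      rw [hF a ha (l + j), norm_zero] at h
      exact norm_eq_zero.1 h
    have hB : ∀ s ∈ Icc (0 : ℝ) 1,
        ‖iteratedFDeriv ℝ m (iteratedFDeriv ℝ l (F : (Fin 2 → E) → ℂ)) (a + s • w)‖ ≤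
          2 ^ k * 2 ^ k * S / (1 + ‖x‖) ^ k := by
      intro s hs
      rw [norm_iteratedFDeriv_iteratedFDeriv]
      have hpos : 0 < (1 + ‖x‖) ^ k := by positivity
      rw [le_div_iff₀ hpos]
      -- `1 + ‖x‖ ≤ 2 (1 + ‖a + s • w‖)`
      have hxy : x = (a + s • w) + (1 - s) • w := by
        rw [← hxw]; simp only [one_smul, sub_smul]; abel
      have hw1 : ‖(1 - s) • w‖ ≤ 1 := by
        rw [norm_smul, Real.norm_of_nonneg (by linarith [hs.2])]
        calc (1 - s) * ‖w‖ ≤ 1 * 1 := by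
              apply mul_le_mul (by linarith [hs.1]) (hw.trans hξ) (norm_nonneg _) zero_le_one
          _ = 1 := one_mul _
      have hx1 : 1 + ‖x‖ ≤ 2 * (1 + ‖a + s • w‖) := by
        have : ‖x‖ ≤ ‖a + s • w‖ + ‖(1 - s) • w‖ := by
          conv_lhs => rw [hxy]
          exact norm_add_le _ _
        linarith [norm_nonneg (a + s • w)]
      calc ‖iteratedFDeriv ℝ (l + m) (F : (Fin 2 → E) → ℂ) (a + s • w)‖ * (1 + ‖x‖) ^ k
          ≤ ‖iteratedFDeriv ℝ (l + m) (F : (Fin 2 → E) → ℂ) (a + s • w)‖ *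
              (2 * (1 + ‖a + s • w‖)) ^ k := by
            gcongr
        _ = 2 ^ k * ((1 + ‖a + s • w‖) ^ k *
              ‖iteratedFDeriv ℝ (l + m) (F : (Fin 2 → E) → ℂ) (a + s • w)‖) := by rw [mul_pow]; ring
        _ ≤ 2 ^ k * (2 ^ k * S) :=
            mul_le_mul_of_nonneg_left (hdec (l + m) (by omega) _) (by positivity)
        _ = 2 ^ k * 2 ^ k * S := by ring
    have h := norm_le_of_iteratedFDeriv_eq_zero m _ a w _ hg h0 hB 1 ⟨zero_le_one, le_rfl⟩
    rw [hxw] at h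
    have hpos : 0 < (1 + ‖x‖) ^ k := by positivity
    calc (1 + ‖x‖) ^ k * ‖iteratedFDeriv ℝ l (F : (Fin 2 → E) → ℂ) x‖
        ≤ (1 + ‖x‖) ^ k * (2 ^ k * 2 ^ k * S / (1 + ‖x‖) ^ k * ‖w‖ ^ m) := by gcongr
      _ = 2 ^ k * 2 ^ k * S * ‖w‖ ^ m := by field_simp
      _ ≤ 2 ^ k * 2 ^ k * S * ‖x 0 - x 1‖ ^ m := by gcongr
  · -- far from the diagonal: plain Schwartz decay and `1 ≤ ‖x₀ - x₁‖ ^ m`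
    have h1 : 1 ≤ ‖x 0 - x 1‖ ^ m := one_le_pow₀ (le_of_lt (not_le.1 hξ))
    calc (1 + ‖x‖) ^ k * ‖iteratedFDeriv ℝ l (F : (Fin 2 → E) → ℂ) x‖ ≤ 2 ^ k * S :=
          hdec l (by omega) x
      _ ≤ 2 ^ k * 2 ^ k * S * 1 := by
          have h2 : (1 : ℝ) ≤ 2 ^ k := one_le_pow₀ (by norm_num)
          have h3 : 0 ≤ 2 ^ k * S := by positivity
          calc 2 ^ k * S = 1 * (2 ^ k * S) * 1 := by ring
            _ ≤ 2 ^ k * (2 ^ k * S) * 1 := by gcongr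
            _ = 2 ^ k * 2 ^ k * S * 1 := by ring
      _ ≤ 2 ^ k * 2 ^ k * S * ‖x 0 - x 1‖ ^ m := by gcongr

/-! ## The integrand `K(x₀ - x₁) F(x)` -/

/-- **Rapid decay of the integrand.** If `‖K ξ‖ ≤ A (‖ξ‖ᵖ + ‖ξ‖⁻ᵖ)` off `0` and `F ∈ ⁰𝒮`, then
`(1 + ‖x‖)^k ‖K(x₀ - x₁) F(x)‖` is bounded for every `k`: flatness of `F` at the diagonal beats
`‖x₀ - x₁‖⁻ᵖ`, Schwartz decay beats `‖x₀ - x₁‖ᵖ ≤ (2(1 + ‖x‖))ᵖ`. [folklore] -/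
theorem one_add_pow_mul_norm_kernel_mul_le {E : Type*} [NormedAddCommGroup E] [NormedSpace ℝ E]
    (K : E → ℂ) (A : ℝ) (p : ℕ) (hK : ∀ x : E, x ≠ 0 → ‖K x‖ ≤ A * (‖x‖ ^ p + ‖x‖⁻¹ ^ p))
    (F : 𝓢((Fin 2 → E), ℂ)) (hF : IsOffDiagonal F) (k : ℕ) :
    ∃ C, 0 ≤ C ∧ ∀ x : Fin 2 → E, (1 + ‖x‖) ^ k * ‖K (x 0 - x 1) * F x‖ ≤ C := by
  obtain ⟨C₁, hC₁, h₁⟩ := one_add_pow_mul_norm_iteratedFDeriv_le_of_isOffDiagonal F hF k p 0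
  obtain ⟨C₂, hC₂, h₂⟩ := one_add_pow_mul_norm_iteratedFDeriv_le_of_isOffDiagonal F hF (k + p) 0 0
  refine ⟨|A| * (2 ^ p * C₂ + C₁), by positivity, fun x => ?_⟩
  have hF0 : ∀ y : Fin 2 → E, (1 + ‖y‖) ^ k * ‖F y‖ ≤ C₁ * ‖y 0 - y 1‖ ^ p := fun y => by
    simpa using h₁ 0 le_rfl y
  have hF1 : ∀ y : Fin 2 → E, (1 + ‖y‖) ^ (k + p) * ‖F y‖ ≤ C₂ := fun y => by
    simpa using h₂ 0 le_rfl y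
  by_cases hx : x 0 - x 1 = 0
  · have hxc : x ∈ coincidenceLocus 2 E := ⟨0, 1, by decide, sub_eq_zero.1 hx⟩
    rw [hF.apply_eq_zero hxc, mul_zero, norm_zero, mul_zero]
    positivity
  · have hξpos : 0 < ‖x 0 - x 1‖ := norm_pos_iff.2 hx
    have hξle : ‖x 0 - x 1‖ ≤ 2 * (1 + ‖x‖) := by
      calc ‖x 0 - x 1‖ ≤ ‖x 0‖ + ‖x 1‖ := norm_sub_le _ _
        _ ≤ ‖x‖ + ‖x‖ := add_le_add (norm_le_pi_norm x 0) (norm_le_pi_norm x 1)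
        _ ≤ 2 * (1 + ‖x‖) := by linarith [norm_nonneg x]
    have hA : ‖K (x 0 - x 1)‖ ≤ |A| * (‖x 0 - x 1‖ ^ p + ‖x 0 - x 1‖⁻¹ ^ p) :=
      (hK _ hx).trans (mul_le_mul_of_nonneg_right (le_abs_self A) (by positivity))
    have hpiece1 : ‖x 0 - x 1‖ ^ p * ((1 + ‖x‖) ^ k * ‖F x‖) ≤ 2 ^ p * C₂ := by
      calc ‖x 0 - x 1‖ ^ p * ((1 + ‖x‖) ^ k * ‖F x‖)
          ≤ (2 * (1 + ‖x‖)) ^ p * ((1 + ‖x‖) ^ k * ‖F x‖) := by gcongr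
        _ = 2 ^ p * ((1 + ‖x‖) ^ (k + p) * ‖F x‖) := by rw [mul_pow, pow_add]; ring
        _ ≤ 2 ^ p * C₂ := by gcongr; exact hF1 x
    have hpiece2 : ‖x 0 - x 1‖⁻¹ ^ p * ((1 + ‖x‖) ^ k * ‖F x‖) ≤ C₁ := by
      calc ‖x 0 - x 1‖⁻¹ ^ p * ((1 + ‖x‖) ^ k * ‖F x‖)
          ≤ ‖x 0 - x 1‖⁻¹ ^ p * (C₁ * ‖x 0 - x 1‖ ^ p) :=
            mul_le_mul_of_nonneg_left (hF0 x) (by positivity)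
        _ = C₁ * (‖x 0 - x 1‖⁻¹ * ‖x 0 - x 1‖) ^ p := by rw [mul_pow]; ring
        _ = C₁ := by rw [inv_mul_cancel₀ hξpos.ne', one_pow, mul_one]
    calc (1 + ‖x‖) ^ k * ‖K (x 0 - x 1) * F x‖
        = ‖K (x 0 - x 1)‖ * ((1 + ‖x‖) ^ k * ‖F x‖) := by rw [norm_mul]; ring
      _ ≤ |A| * (‖x 0 - x 1‖ ^ p + ‖x 0 - x 1‖⁻¹ ^ p) * ((1 + ‖x‖) ^ k * ‖F x‖) := by gcongr
      _ = |A| * (‖x 0 - x 1‖ ^ p * ((1 + ‖x‖) ^ k * ‖F x‖) +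
            ‖x 0 - x 1‖⁻¹ ^ p * ((1 + ‖x‖) ^ k * ‖F x‖)) := by ring
      _ ≤ |A| * (2 ^ p * C₂ + C₁) := by gcongr

/-- **Continuity of the integrand.** With `K` continuous off `0` and polynomially bounded and
`F ∈ ⁰𝒮`, the integrand `x ↦ K(x₀ - x₁) F(x)` is continuous everywhere (it tends to `0` at the
diagonal by flatness). [folklore] -/
theorem continuous_kernel_mul_of_isOffDiagonal {E : Type*} [NormedAddCommGroup E] [NormedSpace ℝ E]
    (K : E → ℂ) (hKc : ContinuousOn K {x | x ≠ 0}) (A : ℝ) (p : ℕ)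
    (hK : ∀ x : E, x ≠ 0 → ‖K x‖ ≤ A * (‖x‖ ^ p + ‖x‖⁻¹ ^ p))
    (F : 𝓢((Fin 2 → E), ℂ)) (hF : IsOffDiagonal F) :
    Continuous fun x : Fin 2 → E => K (x 0 - x 1) * F x := by
  have hπ : Continuous fun x : Fin 2 → E => x 0 - x 1 :=
    (continuous_apply 0).sub (continuous_apply 1)
  refine continuous_iff_continuousAt.2 fun x => ?_
  by_cases hx : x 0 - x 1 = 0
  · obtain ⟨C₁, hC₁, h₁⟩ := one_add_pow_mul_norm_iteratedFDeriv_le_of_isOffDiagonal F hF 0 (p + 1) 0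
    have hF0 : ∀ y : Fin 2 → E, ‖F y‖ ≤ C₁ * ‖y 0 - y 1‖ ^ (p + 1) := fun y => by
      simpa using h₁ 0 le_rfl y
    have hxc : x ∈ coincidenceLocus 2 E := ⟨0, 1, by decide, sub_eq_zero.1 hx⟩
    have hval : K (x 0 - x 1) * F x = 0 := by rw [hF.apply_eq_zero hxc, mul_zero]
    have hbd : ∀ y : Fin 2 → E, ‖K (y 0 - y 1) * F y‖ ≤
        |A| * (‖y 0 - y 1‖ ^ p * ‖F y‖ + C₁ * ‖y 0 - y 1‖) := by
      intro y
      by_cases hy : y 0 - y 1 = 0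
      · have hyc : y ∈ coincidenceLocus 2 E := ⟨0, 1, by decide, sub_eq_zero.1 hy⟩
        rw [hF.apply_eq_zero hyc, mul_zero, norm_zero]
        positivity
      · have hypos : 0 < ‖y 0 - y 1‖ := norm_pos_iff.2 hy
        have hA : ‖K (y 0 - y 1)‖ ≤ |A| * (‖y 0 - y 1‖ ^ p + ‖y 0 - y 1‖⁻¹ ^ p) :=
          (hK _ hy).trans (mul_le_mul_of_nonneg_right (le_abs_self A) (by positivity))
        have h2 : ‖y 0 - y 1‖⁻¹ ^ p * ‖F y‖ ≤ C₁ * ‖y 0 - y 1‖ := by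
          calc ‖y 0 - y 1‖⁻¹ ^ p * ‖F y‖
              ≤ ‖y 0 - y 1‖⁻¹ ^ p * (C₁ * ‖y 0 - y 1‖ ^ (p + 1)) := by gcongr; exact hF0 y
            _ = C₁ * ‖y 0 - y 1‖ * (‖y 0 - y 1‖⁻¹ * ‖y 0 - y 1‖) ^ p := by
                rw [mul_pow, pow_succ]; ring
            _ = C₁ * ‖y 0 - y 1‖ := by rw [inv_mul_cancel₀ hypos.ne', one_pow, mul_one]
        calc ‖K (y 0 - y 1) * F y‖ = ‖K (y 0 - y 1)‖ * ‖F y‖ := norm_mul _ _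
          _ ≤ |A| * (‖y 0 - y 1‖ ^ p + ‖y 0 - y 1‖⁻¹ ^ p) * ‖F y‖ := by gcongr
          _ = |A| * (‖y 0 - y 1‖ ^ p * ‖F y‖ + ‖y 0 - y 1‖⁻¹ ^ p * ‖F y‖) := by ring
          _ ≤ |A| * (‖y 0 - y 1‖ ^ p * ‖F y‖ + C₁ * ‖y 0 - y 1‖) := by gcongr
    have hc : Continuous fun y : Fin 2 → E =>
        |A| * (‖y 0 - y 1‖ ^ p * ‖F y‖ + C₁ * ‖y 0 - y 1‖) :=
      continuous_const.mul (((hπ.norm.pow p).mul F.continuous.norm).add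
        (continuous_const.mul hπ.norm))
    have h0 : |A| * (‖x 0 - x 1‖ ^ p * ‖F x‖ + C₁ * ‖x 0 - x 1‖) = 0 := by
      rw [hF.apply_eq_zero hxc, hx]; simp
    have hg : Tendsto (fun y : Fin 2 → E => |A| * (‖y 0 - y 1‖ ^ p * ‖F y‖ + C₁ * ‖y 0 - y 1‖))
        (𝓝 x) (𝓝 0) := by simpa [h0] using hc.tendsto x
    rw [ContinuousAt, hval]
    exact squeeze_zero_norm hbd hg
  · have hKx : ContinuousAt K (x 0 - x 1) := hKc.continuousAt (isOpen_ne.mem_nhds hx)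
    exact (ContinuousAt.comp (f := fun y : Fin 2 → E => y 0 - y 1) hKx hπ.continuousAt).mul
      F.continuous.continuousAt

/-- **Integrability of the integrand** on `(ℝ⁴)²`: `K(x₀ - x₁) F(x)` is continuous and bounded by
`C (1 + ‖x‖)⁻⁹`, which is integrable in dimension `8`. [folklore] -/
theorem integrable_kernel_mul_of_isOffDiagonal
    (K : EuclideanSpace ℝ (Fin 4) → ℂ) (hKc : ContinuousOn K {x | x ≠ 0}) (A : ℝ) (p : ℕ)
    (hK : ∀ x : EuclideanSpace ℝ (Fin 4), x ≠ 0 → ‖K x‖ ≤ A * (‖x‖ ^ p + ‖x‖⁻¹ ^ p))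
    (F : 𝓢((Fin 2 → EuclideanSpace ℝ (Fin 4)), ℂ)) (hF : IsOffDiagonal F) :
    Integrable (fun x : Fin 2 → EuclideanSpace ℝ (Fin 4) => K (x 0 - x 1) * F x) := by
  obtain ⟨C, hC, hb⟩ := one_add_pow_mul_norm_kernel_mul_le K A p hK F hF 9
  have h9 : (Module.finrank ℝ (Fin 2 → EuclideanSpace ℝ (Fin 4)) : ℝ) < 9 := by
    simp [Module.finrank_pi_fintype]; norm_num
  have hint := (integrable_one_add_norm
    (μ := (volume : Measure (Fin 2 → EuclideanSpace ℝ (Fin 4)))) h9).const_mul C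
  refine hint.mono' (continuous_kernel_mul_of_isOffDiagonal K hKc A p hK F hF).aestronglyMeasurable
    (Eventually.of_forall fun x => ?_)
  have hpos : 0 < (1 + ‖x‖) ^ (9 : ℝ) := by positivity
  rw [Real.rpow_neg (by positivity), ← div_eq_mul_inv, le_div_iff₀ hpos, mul_comm]
  calc (1 + ‖x‖) ^ (9 : ℝ) * ‖K (x 0 - x 1) * F x‖
      = (1 + ‖x‖) ^ (9 : ℕ) * ‖K (x 0 - x 1) * F x‖ := by
        rw [← Real.rpow_natCast]; norm_num
    _ ≤ C := hb x

/-- **Sub-goal `OffDiagonalIntegrability`** (helper for stub `OffDiagonalExtension`): for `K`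
continuous off `0` and polynomially bounded at `0` and `∞`, and every `F ∈ ⁰𝒮((ℝ⁴)²)`, the integrand
`K(x₀ - x₁) F(x)` is continuous and integrable. [folklore] -/
theorem OffDiagonalIntegrability : open Literature.MathematicalPhysics.AQFT in ∀ (K : EuclideanSpace ℝ (Fin 4) → ℂ), ContinuousOn K {x : EuclideanSpace ℝ (Fin 4) | x ≠ 0} → (∃ (A : ℝ) (p : ℕ), ∀ x : EuclideanSpace ℝ (Fin 4), x ≠ 0 → ‖K x‖ ≤ A * (‖x‖ ^ p + ‖x‖⁻¹ ^ p)) → ∀ F : SchwartzMap (Fin 2 → EuclideanSpace ℝ (Fin 4)) ℂ, IsOffDiagonal F → (Continuous fun x : Fin 2 → EuclideanSpace ℝ (Fin 4) => K (x 0 - x 1) * F x) ∧ MeasureTheory.Integrable (fun x : Fin 2 → EuclideanSpace ℝ (Fin 4) => K (x 0 - x 1) * F x) := by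
  intro K hKc hK F hF
  obtain ⟨A, p, hAp⟩ := hK
  exact ⟨continuous_kernel_mul_of_isOffDiagonal K hKc A p hAp F hF,
    integrable_kernel_mul_of_isOffDiagonal K hKc A p hAp F hF⟩

end Summit.QuantumFields.YangMills.Theorems.CurvatureKernel

end
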